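import Literature.Topology.PlaneTopology.EilenbergCriterion
import Mathlib.Topology.Separation.Profinite
import HarnessLib

/-!
# Route `ScrewDustWall` (X-11 «DUST WALL»): the plane-topology kernel of item `DustDoesNotSeparate`
(stmt-RiemannHypothesis-21692)

Classical plane topology (ζ-free, RH-free): **a closed set whose trace on the open unit disc is
totally disconnected does not separate the disc** — if `T ⊆ ℂ` is closed and `T ∩ 𝔻` is totally disconnected then
`𝔻 ∖ T` is preconnected (Sierpiński / Mazurkiewicz / Menger: a closed zero-dimensional set does
not separate a planar domain; Kuratowski, *Topology* II, §59; Hurewicz–Wallman, Thm IV 4).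

## Proof (Eilenberg–Borsuk, via the tree's `Literature.Topology.PlaneTopology.EilenbergCriterion`)

Suppose `𝔻 ∖ T = A ⊔ B` with `A`, `B` open, `a ∈ A`, `b ∈ B`.  The compact set
`K := closedBall 0 1 ∖ (𝔻 ∖ T) = sphere 0 1 ∪ (T ∩ 𝔻)` misses `a` and `b`, and the component
of `a` in `ℂ ∖ K = A ⊔ (B ∪ {1 < ‖z‖})` lies in `A`: it is bounded and misses `b`.  By the hard
direction of Eilenberg's criterion (`not_hasLogOn_div_sub`, Borsuk) the map
`z ↦ (z - a)/(z - b)` has NO continuous logarithm on `K`.  But it has one: with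
`ρ := max ‖a‖ ‖b‖ < ρ₁ < 1`, split `K = P ⊔ Q` where `P ⊇ T ∩ closedBall 0 ρ` is a finite union
of compact clopen pieces of the compact totally disconnected space `T ∩ closedBall 0 ρ₁`
(`compact_exists_isClopen_in_isOpen`) lying in `ball 0 ρ₁`, and `Q := K ∖ P` is closed and
contained in `{ρ < ‖z‖}`.  On `Q` the ratio equals `(1 - a/z)/(1 - b/z)`, two factors in the disc
`‖w - 1‖ < 1` (principal branch); on the compact totally disconnected `P` EVERY nonvanishing
continuous map has a continuous logarithm (`hasLogOn_of_isTotallyDisconnected`: cover by clopen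
pieces on which the map stays in a disc `‖w - w₀‖ < ‖w₀‖`, glue along the empty intersections);
the two logarithms glue across the empty intersection `P ∩ Q` (`Janiszewski.exists_log_union`).

The by-name closer `DustDoesNotSeparate_proof : …Theses.ScrewDustWall.DustDoesNotSeparate` is the
two-line file `ScrewDustDoesNotSeparate.lean` (it only adds the import of the gate-rendered route file).
RH is not proved by this file and nothing here bears on the truth of RH: this is the plane-topology
support of the RH-equivalence X-11 (`CEIL(1) ∧ TD(1) ⟹ RH`).

## References
* S. Eilenberg, Transformations continues en circonférence et la topologie du plan, Fund. Math.
  26 (1936) 61–112 (Thm. 4: the logarithm criterion). [Eilenberg1936]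
* K. Kuratowski, *Topology* vol. II, Academic Press (1968), §59 II and §61. [Kuratowski1968]
-/

noncomputable section

set_option linter.dupNamespace false

namespace Summit.RiemannHypothesis.RiemannHypothesis.Theorems.Splittings.ScrewDust

open Complex Set Metric Topology Filter
open Literature.Topology.PlaneTopology

/-! ### Continuous logarithms on compact totally disconnected sets -/

/-- On a compact Hausdorff totally disconnected space every continuous nowhere-vanishing map into
`ℂ` has a continuous logarithm: cover the space by finitely many clopen sets on each of which the
map stays in the disc `‖w - w₀‖ < ‖w₀‖` about one of its values (principal branch there), and glue
along the empty intersections of the disjointified pieces. [folklore] -/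
theorem hasLogOn_univ_of_totallyDisconnectedSpace {X : Type*} [TopologicalSpace X]
    [CompactSpace X] [T2Space X] [TotallyDisconnectedSpace X] {g : X → ℂ}
    (hg : Continuous g) (hg0 : ∀ x, g x ≠ 0) : HasLogOn g univ := by
  classical
  have hW : ∀ x : X, ∃ W : Set X, IsClopen W ∧ x ∈ W ∧ ∀ y ∈ W, ‖g y - g x‖ < ‖g x‖ := by
    intro x
    have hV : IsOpen {y : X | ‖g y - g x‖ < ‖g x‖} := isOpen_lt (by fun_prop) continuous_const
    have hxV : x ∈ {y : X | ‖g y - g x‖ < ‖g x‖} := by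
      simp only [mem_setOf_eq, sub_self, norm_zero, norm_pos_iff]
      exact hg0 x
    obtain ⟨W, hWc, hxW, hWV⟩ := compact_exists_isClopen_in_isOpen hV hxV
    exact ⟨W, hWc, hxW, fun y hy => hWV hy⟩
  choose W hWc hxW hWg using hW
  have hlogW : ∀ x, HasLogOn g (W x) := fun x =>
    hasLogOn_of_norm_sub_lt hg.continuousOn (hasLogOn_const (hg0 x) _) (hWg x)
  obtain ⟨t, ht⟩ := isCompact_univ.elim_finite_subcover W (fun x => (hWc x).isOpen)
    (fun x _ => mem_iUnion.2 ⟨x, hxW x⟩)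
  have key : ∀ s : Finset X, HasLogOn g (⋃ x ∈ s, W x) := by
    intro s
    induction s using Finset.induction_on with
    | empty => simpa using hasLogOn_empty g
    | @insert a s _ ih =>
      have hUo : IsOpen (⋃ x ∈ s, W x) := isOpen_biUnion fun x _ => (hWc x).isOpen
      have hUc : IsClosed (⋃ x ∈ s, W x) := isClosed_biUnion_finset fun x _ => (hWc x).isClosed
      have h1 : HasLogOn g (W a \ ⋃ x ∈ s, W x) := (hlogW a).mono sdiff_subset
      have h2 := h1.union_of_isOpen ((hWc a).isOpen.sdiff hUc) hUo
        (by rw [sdiff_inter_self]; exact isPreconnected_empty) ih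
      rwa [sdiff_union_self, ← Finset.set_biUnion_insert] at h2
  exact (key t).mono ht

/-- **Nonvanishing maps on compact totally disconnected plane sets have continuous logarithms.**
If `K ⊆ ℂ` is compact and totally disconnected and `f` is continuous and nowhere zero on `K`, then
`f` has a continuous logarithm on `K`. [folklore] -/
theorem hasLogOn_of_isTotallyDisconnected {K : Set ℂ} (hK : IsCompact K)
    (hKt : IsTotallyDisconnected K) {f : ℂ → ℂ} (hf : ContinuousOn f K)
    (hf0 : ∀ z ∈ K, f z ≠ 0) : HasLogOn f K := by
  classical
  haveI : CompactSpace K := isCompact_iff_compactSpace.1 hK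
  haveI : TotallyDisconnectedSpace K := totallyDisconnectedSpace_subtype_iff.2 hKt
  have hg : Continuous (fun y : K => f y) := hf.restrict
  obtain ⟨l, hl, hle⟩ := hasLogOn_univ_of_totallyDisconnectedSpace hg (fun y => hf0 y y.2)
  refine ⟨fun z => if hz : z ∈ K then l ⟨z, hz⟩ else 0, ?_, fun z hz => ?_⟩
  · rw [continuousOn_iff_continuous_restrict]
    have : (K.restrict fun z => if hz : z ∈ K then l ⟨z, hz⟩ else 0) = l := by
      ext w
      simp [w.2]
    rw [this]
    exact continuousOn_univ.1 hl
  · simp only [hz, dif_pos]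
    exact hle ⟨z, hz⟩ (mem_univ _)

/-! ### The ratio `(z - a)/(z - b)` outside a disc containing `a` and `b` -/

/-- Outside the closed disc `‖z‖ ≤ ρ` containing `a` and `b`, the ratio `(z - a)/(z - b)` equals
`(1 - a/z)/(1 - b/z)`, a quotient of two maps with values in the disc `‖w - 1‖ < 1`, so it has a
continuous logarithm there. [folklore] -/
theorem hasLogOn_div_sub_of_norm_le {a b : ℂ} {ρ : ℝ} (ha : ‖a‖ ≤ ρ) (hb : ‖b‖ ≤ ρ) :
    HasLogOn (fun z => (z - a) / (z - b)) {z : ℂ | ρ < ‖z‖} := by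
  have hρ : 0 ≤ ρ := (norm_nonneg a).trans ha
  have hz0 : ∀ z ∈ {z : ℂ | ρ < ‖z‖}, z ≠ 0 := fun z hz h => by
    simp only [mem_setOf_eq, h, norm_zero] at hz
    linarith
  have h1 : ∀ c : ℂ, ‖c‖ ≤ ρ → HasLogOn (fun z => 1 - c / z) {z : ℂ | ρ < ‖z‖} := by
    intro c hc
    refine hasLogOn_of_norm_sub_one_lt ?_ fun z hz => ?_
    · exact continuousOn_const.sub (continuousOn_const.div continuousOn_id hz0)
    · rw [sub_sub_cancel_left, norm_neg, norm_div, div_lt_one (hρ.trans_lt hz)]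
      exact hc.trans_lt hz
  refine ((h1 a ha).div (h1 b hb)).congr fun z hz => ?_
  have hz' : z ≠ 0 := hz0 z hz
  simp only
  rw [one_sub_div hz', one_sub_div hz', div_div_div_cancel_right₀ hz']

/-! ### The non-separation theorem -/

/-- **A closed set with totally disconnected trace on the disc does not separate the disc**:
if `T ⊆ ℂ` is closed and `T ∩ 𝔻` is totally disconnected, then `𝔻 ∖ T` is preconnected.
[cite: Eilenberg1936, Thm. 4; Kuratowski1968, §59 II] -/
theorem isPreconnected_ball_diff_of_isTotallyDisconnected {T : Set ℂ} (hT : IsClosed T)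
    (hTd : IsTotallyDisconnected (T ∩ ball (0 : ℂ) 1)) :
    IsPreconnected (ball (0 : ℂ) 1 \ T) := by
  classical
  set s : Set ℂ := ball (0 : ℂ) 1 \ T with hs_def
  have hso : IsOpen s := isOpen_ball.sdiff hT
  rw [isPreconnected_iff_subset_of_disjoint]
  intro u v hu hv hsuv hdisj
  by_contra h
  push Not at h
  obtain ⟨hnu, hnv⟩ := h
  obtain ⟨b, hbs, hbu⟩ := not_subset.1 hnu
  obtain ⟨a, has, hav⟩ := not_subset.1 hnv
  have hau : a ∈ u := (hsuv has).resolve_right hav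
  have hbv : b ∈ v := (hsuv hbs).resolve_left hbu
  -- the two open pieces of `s`
  set A : Set ℂ := s ∩ u with hA_def
  set B : Set ℂ := s ∩ v with hB_def
  have hAo : IsOpen A := hso.inter hu
  have hBo : IsOpen B := hso.inter hv
  have hAB : Disjoint A B := by
    rw [Set.disjoint_iff_inter_eq_empty, ← subset_empty_iff, ← hdisj]
    rintro z ⟨⟨hzs, hzu⟩, -, hzv⟩
    exact ⟨hzs, hzu, hzv⟩
  -- the compact set `K = sphere 0 1 ∪ (T ∩ 𝔻)`
  set K : Set ℂ := closedBall (0 : ℂ) 1 \ s with hK_def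
  have hK : IsCompact K := (isCompact_closedBall 0 1).diff hso
  have haK : a ∉ K := fun h => h.2 has
  have hbK : b ∉ K := fun h => h.2 hbs
  have hKT : ∀ z ∈ K, ‖z‖ < 1 → z ∈ T := by
    rintro z ⟨-, hzs⟩ hz1
    by_contra hzT
    exact hzs ⟨mem_ball_zero_iff.2 hz1, hzT⟩
  have hTK : ∀ z ∈ T, ‖z‖ < 1 → z ∈ K := fun z hzT hz1 =>
    ⟨mem_closedBall_zero_iff.2 hz1.le, fun h => h.2 hzT⟩
  -- the component of `a` in `ℂ ∖ K` lies in `A`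
  have hKc : Kᶜ ⊆ A ∪ (B ∪ (closedBall (0 : ℂ) 1)ᶜ) := by
    intro z hz
    by_cases hzc : z ∈ closedBall (0 : ℂ) 1
    · have hzs : z ∈ s := by
        by_contra h'
        exact hz ⟨hzc, h'⟩
      rcases hsuv hzs with hzu | hzv
      · exact Or.inl ⟨hzs, hzu⟩
      · exact Or.inr (Or.inl ⟨hzs, hzv⟩)
    · exact Or.inr (Or.inr hzc)
  have hAcb : A ⊆ closedBall (0 : ℂ) 1 := fun z hz => ball_subset_closedBall hz.1.1
  have hCA : connectedComponentIn Kᶜ a ⊆ A := by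
    refine isPreconnected_connectedComponentIn.subset_left_of_subset_union hAo
      (hBo.union isClosed_closedBall.isOpen_compl) ?_
      ((connectedComponentIn_subset _ _).trans hKc) ⟨a, mem_connectedComponentIn haK, has, hau⟩
    exact Disjoint.union_right hAB (disjoint_compl_right.mono_left hAcb)
  have hbdd : Bornology.IsBounded (connectedComponentIn Kᶜ a) :=
    isBounded_closedBall.subset (hCA.trans hAcb)
  have hbC : b ∉ connectedComponentIn Kᶜ a := fun h =>
    Set.disjoint_left.1 hAB (hCA h) ⟨hbs, hbv⟩
  refine not_hasLogOn_div_sub hK haK hbK hbdd hbC ?_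
  -- ⊢ the ratio HAS a continuous logarithm on `K`: split `K = P ⊔ Q`
  set ρ : ℝ := max ‖a‖ ‖b‖ with hρ_def
  have hρ1 : ρ < 1 := max_lt (mem_ball_zero_iff.1 has.1) (mem_ball_zero_iff.1 hbs.1)
  obtain ⟨ρ₁, hρρ₁, hρ₁1⟩ := exists_between hρ1
  -- the compact totally disconnected space `K₁ = T ∩ closedBall 0 ρ₁`
  set K₁ : Set ℂ := T ∩ closedBall (0 : ℂ) ρ₁ with hK₁_def
  have hK₁c : IsCompact K₁ := (isCompact_closedBall 0 ρ₁).inter_left hT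
  have hK₁T : IsTotallyDisconnected K₁ := fun t ht htp =>
    hTd t (ht.trans fun z hz => ⟨hz.1, mem_ball_zero_iff.2
      ((mem_closedBall_zero_iff.1 hz.2).trans_lt hρ₁1)⟩) htp
  haveI : CompactSpace K₁ := isCompact_iff_compactSpace.1 hK₁c
  haveI : TotallyDisconnectedSpace K₁ := totallyDisconnectedSpace_subtype_iff.2 hK₁T
  -- clopen pieces of small diameter around the points of norm `≤ ρ`
  have hW : ∀ x : K₁, ∃ W : Set K₁, IsClopen W ∧ (‖(x : ℂ)‖ ≤ ρ → x ∈ W) ∧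
      ∀ y ∈ W, ‖(y : ℂ)‖ < ρ₁ := by
    intro x
    by_cases hx : ‖(x : ℂ)‖ ≤ ρ
    · have hV : IsOpen {y : K₁ | dist y x < ρ₁ - ρ} := isOpen_lt (by fun_prop) continuous_const
      have hxV : x ∈ {y : K₁ | dist y x < ρ₁ - ρ} := by
        simp only [mem_setOf_eq, dist_self, sub_pos, hρρ₁]
      obtain ⟨W, hWc, hxW, hWV⟩ := compact_exists_isClopen_in_isOpen hV hxV
      refine ⟨W, hWc, fun _ => hxW, fun y hy => ?_⟩
      have hyx : dist (y : ℂ) x < ρ₁ - ρ := hWV hy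
      calc ‖(y : ℂ)‖ = dist (y : ℂ) 0 := (dist_zero_right _).symm
        _ ≤ dist (y : ℂ) x + dist (x : ℂ) 0 := dist_triangle _ _ _
        _ < (ρ₁ - ρ) + ρ := by
            rw [dist_zero_right]
            exact add_lt_add_of_lt_of_le hyx hx
        _ = ρ₁ := by ring
    · exact ⟨∅, isClopen_empty, fun h => (hx h).elim, fun y hy => hy.elim⟩
  choose W hWc hxW hWρ using hW
  -- finitely many pieces cover the compact set `{‖x‖ ≤ ρ}`
  have hK₀ : IsCompact {x : K₁ | ‖(x : ℂ)‖ ≤ ρ} := (isClosed_le (by fun_prop) continuous_const).isCompact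
  obtain ⟨t, ht⟩ := hK₀.elim_finite_subcover W (fun x => (hWc x).isOpen)
    (fun x hx => mem_iUnion.2 ⟨x, hxW x hx⟩)
  set Ws : Set K₁ := ⋃ x ∈ t, W x with hWs_def
  have hWs : IsClopen Ws := isClopen_biUnion_finset fun x _ => hWc x
  obtain ⟨O, hO, hOWs⟩ := isOpen_induced_iff.1 hWs.isOpen
  set P : Set ℂ := ((↑) : K₁ → ℂ) '' Ws with hP_def
  have hPc : IsCompact P := hWs.isClosed.isCompact.image continuous_subtype_val
  have hPK₁O : P = K₁ ∩ O := by rw [hP_def, ← hOWs, Subtype.image_preimage_coe]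
  have hPρ₁ : ∀ z ∈ P, ‖z‖ < ρ₁ := by
    rintro z ⟨y, hy, rfl⟩
    obtain ⟨x, hx, hyx⟩ := mem_iUnion₂.1 hy
    exact hWρ x y hyx
  have hPT : P ⊆ T := fun z hz => (hPK₁O ▸ hz : z ∈ K₁ ∩ O).1.1
  have hPK : P ⊆ K := fun z hz => hTK z (hPT hz) ((hPρ₁ z hz).trans hρ₁1)
  have hPtd : IsTotallyDisconnected P := fun t' ht' htp =>
    hK₁T t' (ht'.trans fun z hz => (hPK₁O ▸ hz : z ∈ K₁ ∩ O).1) htp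
  -- the open set `O' = O ∩ ball 0 ρ₁` cuts exactly `P` out of `K`
  set O' : Set ℂ := O ∩ ball (0 : ℂ) ρ₁ with hO'_def
  have hO' : IsOpen O' := hO.inter isOpen_ball
  have hPO' : P ⊆ O' := fun z hz => ⟨(hPK₁O ▸ hz : z ∈ K₁ ∩ O).2, mem_ball_zero_iff.2 (hPρ₁ z hz)⟩
  have hKO'P : K ∩ O' ⊆ P := by
    rintro z ⟨hzK, hzO, hzρ₁⟩
    have hz1 : ‖z‖ < ρ₁ := mem_ball_zero_iff.1 hzρ₁
    rw [hPK₁O]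
    exact ⟨⟨hKT z hzK (hz1.trans hρ₁1), mem_closedBall_zero_iff.2 hz1.le⟩, hzO⟩
  set Q : Set ℂ := K \ O' with hQ_def
  have hQc : IsClosed Q := hK.isClosed.sdiff hO'
  have hPQK : P ∪ Q = K := by
    refine Subset.antisymm (union_subset hPK sdiff_subset) fun z hzK => ?_
    by_cases hzO' : z ∈ O'
    · exact Or.inl (hKO'P ⟨hzK, hzO'⟩)
    · exact Or.inr ⟨hzK, hzO'⟩
  have hPQ : P ∩ Q = ∅ := by
    rw [← subset_empty_iff]
    rintro z ⟨hzP, -, hzO'⟩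
    exact hzO' (hPO' hzP)
  have hQρ : Q ⊆ {z : ℂ | ρ < ‖z‖} := by
    rintro z ⟨hzK, hzO'⟩
    rw [mem_setOf_eq]
    by_contra hzρ
    push Not at hzρ
    have hzT : z ∈ T := hKT z hzK (hzρ.trans_lt hρ1)
    have hzK₁ : z ∈ K₁ := ⟨hzT, mem_closedBall_zero_iff.2 (hzρ.trans hρρ₁.le)⟩
    have hzWs : (⟨z, hzK₁⟩ : K₁) ∈ Ws := ht (show (⟨z, hzK₁⟩ : K₁) ∈ {x : K₁ | ‖(x : ℂ)‖ ≤ ρ} from hzρ)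
    exact hzO' (hPO' ⟨⟨z, hzK₁⟩, hzWs, rfl⟩)
  -- logarithms on the two pieces, glued across the empty intersection
  set f : ℂ → ℂ := fun z => (z - a) / (z - b) with hf_def
  have hfQ : HasLogOn f Q :=
    (hasLogOn_div_sub_of_norm_le (le_max_left _ _) (le_max_right _ _)).mono hQρ
  have hf0 : ∀ z ∈ K, f z ≠ 0 := fun z hz =>
    div_ne_zero (sub_ne_zero.2 fun h => haK (h ▸ hz)) (sub_ne_zero.2 fun h => hbK (h ▸ hz))
  have hfc : ContinuousOn f K :=
    ContinuousOn.div (by fun_prop) (by fun_prop) fun z hz => sub_ne_zero.2 fun h => hbK (h ▸ hz)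
  have hfP : HasLogOn f P :=
    hasLogOn_of_isTotallyDisconnected hPc hPtd (hfc.mono hPK) fun z hz => hf0 z (hPK hz)
  obtain ⟨gP, hgP, hgPe⟩ := hfP
  obtain ⟨gQ, hgQ, hgQe⟩ := hfQ
  obtain ⟨g, hg, hge⟩ := Janiszewski.exists_log_union hPc.isClosed hQc
    (by rw [hPQ]; exact isPreconnected_empty) (fun z hz => hf0 z (sdiff_subset hz))
    hgP hgPe hgQ hgQe
  rw [hPQK] at hg hge
  exact ⟨g, hg, hge⟩

end Summit.RiemannHypothesis.RiemannHypothesis.Theorems.Splittings.ScrewDust
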